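import Summits.Ventures.HSemireg.WedgeHankelClassSpaceMonoid
import Summits.Ventures.HSemireg.WedgeHankelSubstitutionSingularSpectrum

/-!
# Venture HSemireg — EVERY NON-ZERO SINGULAR SUBSTITUTION HAS RANK ONE ON TH-7's CLASSES (`n ≥ 1`): `dim range SbC(g) = 1`, `dim ker SbC(g) = n` for `αδ = βγ`, `g ≠ 0`, in all
# three degenerate frames (`α ≠ 0`: the pure line of `x + (β/α)y`, I12; `α = γ = 0`: the line of the point class `E_n`; `α = β = 0`: the line of `w_n(γ^{n−j}δ^j)`), which with
# J1's minimal polynomials fixes the JORDAN TYPE: diagonal `(0^{(n)}, (α+δ)^n)` for `α + δ ≠ 0`, one block of size `2` plus `n − 1` blocks of size `1` for a nilpotent `g ≠ 0`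

HONEST FRAMING. Part of the Lean index of the computation cell `pub-hsemireg` (seat p10 gen 20, Sunday typer «UNIFORM-IN-n»).
Finite-dimensional EXTERIOR ALGEBRA + linear algebra ONLY: no variety, no cohomology theory, no sheaf, no Ext group, no semiregularity map;
nothing here says that HC / HC_CM / HC_AV holds; no Literature fact is declared or used.  Custodian versions as in `WedgeHankelSiegelIdeal` (1/3) and `WedgeHankelFrameChange`.

WHAT IS IN THE TREE.  I12 (`WedgeHankelClassSpaceMonoid`): `range_SbC_of_det_eq_zero`, `finrank_range_SbC_of_det_eq_zero = 1`, `finrank_ker_SbC_of_det_eq_zero = n` — all for `α ≠ 0` ONLY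
(«NOT typed: the cases α = 0»); H5: `Sb_w_of_alpha_gamma_zero` (`x ↦ βy, y ↦ δy`), `Sb_w_of_alpha_beta_zero` (`x ↦ 0`); I21 `finrank_ker_add_finrank_range_SbC`, `range_SbC_le_ker_of_nilpotent`;
J1 (`WedgeHankelSubstitutionSingularSpectrum`): `SbC_eq_zero_iff`, the minimal polynomials.  THIS FILE (namespace `Summit.Ventures.HSemireg.Wedge.HankelFrameChange` continued; imports
I12, J1) removes the restriction `α ≠ 0`:
* §245 `range_eq_span_singleton_of_apply`, `exists_coe_eq_w`, **`range_SbC_of_alpha_gamma_zero`** (`(β, δ) ≠ 0 ⇒ range SbC(0 β 0 δ) = K ∙ E_n`), **`range_SbC_of_alpha_beta_zero`**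
  (`range SbC(0 0 γ δ) = K ∙ w_n(γ^{n−j}δ^j)`), `w_frame_pow_ne_zero` (`(γ, δ) ≠ 0 ⇒ w_n(γ^{n−j}δ^j) ≠ 0`).
* §246 **`finrank_range_SbC_eq_one_of_det_eq_zero`: `αδ = βγ`, `g ≠ 0 ⇒ dim range SbC(g) = 1`** and **`finrank_ker_SbC_eq_of_det_eq_zero`: `dim ker SbC(g) = n`** (every
  field; the class space has dimension `n + 1`); the Jordan type follows: **`range_SbC_le_ker_and_finrank_of_nilpotent`** (a non-zero NILPOTENT letter map, `n ≥ 1`: image line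
  inside the kernel hyperplane — one Jordan block of size `2` and `n − 1` of size `1`; J1: `minpoly = X²`) and **`finrank_eigenspace_trace_pow_eq_one`** (`α + δ ≠ 0`: the eigenvalue
  `(α+δ)^n` is SIMPLE, its eigenspace is the image line; J1: `minpoly = X(X − (α+δ)^n)`, diagonalizable).
NOT typed here: anything Ext-side.  New names only.
-/

open Module

namespace Summit.Ventures.HSemireg.Wedge.HankelFrameChange

open Summit.Ventures.HSemireg.Wedge Summit.Ventures.HSemireg.Wedge.Kunneth Summit.Ventures.HSemireg.Wedge.Hankel
  Summit.Ventures.HSemireg.Wedge.BasisFree Summit.Ventures.HSemireg.Wedge.HankelSiegel Summit.Ventures.HSemireg.Wedge.HankelSiegelIdeal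
  Summit.Ventures.HSemireg.Wedge.KunnethKernel Summit.Ventures.HSemireg.Wedge.HankelRankOne Summit.Ventures.HSemireg.Wedge.KernelDuality

variable (K : Type*) [Field K] {n : ℕ}

/-! ## §245. The two frames with `α = 0` -/

section RangeLine

variable {V : Type*} [AddCommGroup V] [Module K V]

/-- a linear map whose values are all multiples of `v`, one of them a NON-ZERO multiple, has range the line `K ∙ v`. -/
theorem range_eq_span_singleton_of_apply {W : Type*} [AddCommGroup W] [Module K W] (T : W →ₗ[K] V) (v : V) (hall : ∀ f, ∃ c : K, T f = c • v)
    {f₀ : W} {c₀ : K} (hc₀ : c₀ ≠ 0) (h₀ : T f₀ = c₀ • v) : LinearMap.range T = K ∙ v := by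
  apply le_antisymm
  · rintro _ ⟨f, rfl⟩
    obtain ⟨c, hc⟩ := hall f
    rw [hc]; exact Submodule.smul_mem _ _ (Submodule.mem_span_singleton_self v)
  · rw [Submodule.span_singleton_le_iff_mem]
    refine ⟨c₀⁻¹ • f₀, ?_⟩
    rw [map_smul, h₀, smul_smul, inv_mul_cancel₀ hc₀, one_smul]

end RangeLine

/-- every element of the class space is a class `w_n(q)` (I8, through `spikeSpan = coSiegel_n`). -/
theorem exists_coe_eq_w (f : spikeSpan K n) : ∃ q : ℕ → K, (f : HT K (In n)) = w K n n q :=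
  exists_eq_w_of_mem_coSiegel K (by rw [← spikeSpan_eq_coSiegel]; exact f.2)

/-- **`α = γ = 0`, `(β, δ) ≠ 0`: the image of the class space under `Sb 0 β 0 δ` (`x ↦ βy`, `y ↦ δy`) is the line of the POINT CLASS `E_n`** (H5 `Sb_w_of_alpha_gamma_zero`; the class
`E_0` goes to `β^n·E_n`, the class `E_n` to `δ^n·E_n`). -/
theorem range_SbC_of_alpha_gamma_zero {β δ : K} (h : β ≠ 0 ∨ δ ≠ 0) :
    LinearMap.range (SbC K 0 β 0 δ (n := n)) = K ∙ (⟨w K n n (fun j => if j = n then (1 : K) else 0), w_mem_spikeSpan K _⟩ : spikeSpan K n) := by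
  have hall : ∀ f : spikeSpan K n, ∃ c : K, SbC K 0 β 0 δ f = c • ⟨w K n n (fun j => if j = n then (1 : K) else 0), w_mem_spikeSpan K _⟩ := fun f => by
    obtain ⟨q, hq⟩ := exists_coe_eq_w K f
    refine ⟨expMul K β (scaleSeq K δ q) n, Subtype.ext ?_⟩
    rw [SbC_apply_coe, hq, Sb_w_of_alpha_gamma_zero, Submodule.coe_smul, ← w_smul]
    exact w_eq_of_agree K n fun j _ => by by_cases hj : j = n <;> simp [hj]
  rcases h with hβ | hδ
  · -- `E_0 ↦ β^n · E_n`
    refine range_eq_span_singleton_of_apply K _ _ hall (f₀ := ⟨w K n n (fun j => if j = 0 then (1 : K) else 0), w_mem_spikeSpan K _⟩) (pow_ne_zero n hβ) (Subtype.ext ?_)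
    rw [SbC_apply_coe, Sb_w_spike_zero, Submodule.coe_smul, ← w_smul]
    refine w_eq_of_agree K n fun j hj => ?_
    by_cases h : j = n
    · rw [h, if_pos rfl, mul_one, Nat.sub_self, pow_zero, one_mul]
    · rw [if_neg h, mul_zero, zero_pow (by omega), zero_mul]
  · -- `E_n ↦ δ^n · E_n`
    refine range_eq_span_singleton_of_apply K _ _ hall (f₀ := ⟨w K n n (fun j => if j = n then (1 : K) else 0), w_mem_spikeSpan K _⟩) (pow_ne_zero n hδ) (Subtype.ext ?_)
    rw [SbC_apply_coe, Sb_w_point_of_upper K 0 β δ le_rfl, Submodule.coe_smul]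

/-- the class `w_n(γ^{n−j} δ^j)` (the image frame's volume class) is non-zero as soon as `(γ, δ) ≠ 0`. -/
theorem w_frame_pow_ne_zero {γ δ : K} (h : γ ≠ 0 ∨ δ ≠ 0) : w K n n (fun j => γ ^ (n - j) * δ ^ j) ≠ 0 := by
  intro h0
  rw [← w_zero K (n := n) n, w_eq_w_iff] at h0
  rcases h with hγ | hδ
  · have e := h0 0 (Nat.zero_le n)
    rw [Nat.sub_zero, pow_zero, mul_one] at e
    exact pow_ne_zero n hγ e
  · have e := h0 n le_rfl
    rw [Nat.sub_self, pow_zero, one_mul] at e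
    exact pow_ne_zero n hδ e

/-- **`α = β = 0`: the image of the class space under `Sb 0 0 γ δ` (`x ↦ 0`, `y ↦ γx + δy`) is the line of `w_n(γ^{n−j}δ^j)`** (H5 `Sb_w_of_alpha_beta_zero`:
`w_n(q) ↦ q_n · w_n(γ^{n−j}δ^j)`; the point class has `q_n = 1`; for `γ = δ = 0`, `n ≥ 1` both sides are `⊥`). -/
theorem range_SbC_of_alpha_beta_zero (γ δ : K) :
    LinearMap.range (SbC K 0 0 γ δ (n := n)) = K ∙ (⟨w K n n (fun j => γ ^ (n - j) * δ ^ j), w_mem_spikeSpan K _⟩ : spikeSpan K n) := by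
  have hall : ∀ f : spikeSpan K n, ∃ c : K, SbC K 0 0 γ δ f = c • ⟨w K n n (fun j => γ ^ (n - j) * δ ^ j), w_mem_spikeSpan K _⟩ := fun f => by
    obtain ⟨q, hq⟩ := exists_coe_eq_w K f
    refine ⟨q n, Subtype.ext ?_⟩
    rw [SbC_apply_coe, hq, Sb_w_of_alpha_beta_zero, Submodule.coe_smul, ← w_smul]
    exact w_eq_of_agree K n fun j _ => by ring
  refine range_eq_span_singleton_of_apply K _ _ hall (f₀ := ⟨w K n n (fun j => if j = n then (1 : K) else 0), w_mem_spikeSpan K _⟩) one_ne_zero (Subtype.ext ?_)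
  rw [SbC_apply_coe, Sb_w_of_alpha_beta_zero, if_pos rfl, Submodule.coe_smul, one_smul]
  exact w_eq_of_agree K n fun j _ => by rw [one_mul]

/-! ## §246. Rank one and nullity `n` for every non-zero singular substitution -/

/-- **EVERY NON-ZERO SINGULAR SUBSTITUTION HAS RANK ONE ON THE CLASSES: `αδ = βγ`, `g ≠ 0 ⇒ dim range SbC(g) = 1`** (I12 for `α ≠ 0`; §245 for the two frames with `α = 0`). -/
theorem finrank_range_SbC_eq_one_of_det_eq_zero {α β γ δ : K} (hdet : α * δ - β * γ = 0) (hg : ¬ (α = 0 ∧ β = 0 ∧ γ = 0 ∧ δ = 0)) :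
    finrank K ↥(LinearMap.range (SbC K α β γ δ (n := n))) = 1 := by
  by_cases hα : α = 0
  · subst hα
    have hβγ : β * γ = 0 := by linear_combination -hdet
    by_cases hβ : β = 0
    · subst hβ
      have h : γ ≠ 0 ∨ δ ≠ 0 := by
        by_contra hno
        push Not at hno
        exact hg ⟨rfl, rfl, hno.1, hno.2⟩
      rw [range_SbC_of_alpha_beta_zero K, finrank_span_singleton]
      exact fun h0 => w_frame_pow_ne_zero K h (congrArg Subtype.val h0)
    · have hγ : γ = 0 := (mul_eq_zero.mp hβγ).resolve_left hβ
      subst hγ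
      rw [range_SbC_of_alpha_gamma_zero K (Or.inl hβ), finrank_span_singleton]
      exact fun h0 => w_spike_ne_zero K le_rfl (congrArg Subtype.val h0)
  · exact finrank_range_SbC_of_det_eq_zero K hα hdet

/-- **… AND NULLITY `n`: `dim ker SbC(g) = n`** for `αδ = βγ`, `g ≠ 0` (rank–nullity on the `(n+1)`-dimensional class space). -/
theorem finrank_ker_SbC_eq_of_det_eq_zero {α β γ δ : K} (hdet : α * δ - β * γ = 0) (hg : ¬ (α = 0 ∧ β = 0 ∧ γ = 0 ∧ δ = 0)) :
    finrank K ↥(LinearMap.ker (SbC K α β γ δ (n := n))) = n := by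
  have h := finrank_ker_add_finrank_range_SbC K (n := n) α β γ δ
  rw [finrank_range_SbC_eq_one_of_det_eq_zero K hdet hg] at h
  omega

/-- **THE NILPOTENT JORDAN TYPE: for a non-zero nilpotent letter map (`αδ = βγ`, `α + δ = 0`, `n ≥ 1`) the image LINE lies inside the kernel HYPERPLANE** — one Jordan block of
size `2` (spanned by a preimage of the image line and the line) and `n − 1` blocks of size `1`; `dim ker = n` blocks in all (J1: `minpoly = X²`). -/
theorem range_SbC_le_ker_and_finrank_of_nilpotent (hn : 1 ≤ n) {α β γ δ : K} (hdet : α * δ - β * γ = 0) (htr : α + δ = 0) (hg : ¬ (α = 0 ∧ β = 0 ∧ γ = 0 ∧ δ = 0)) :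
    LinearMap.range (SbC K α β γ δ (n := n)) ≤ LinearMap.ker (SbC K α β γ δ) ∧
      finrank K ↥(LinearMap.range (SbC K α β γ δ (n := n))) = 1 ∧ finrank K ↥(LinearMap.ker (SbC K α β γ δ (n := n))) = n :=
  ⟨range_SbC_le_ker_of_nilpotent K hdet htr hn, finrank_range_SbC_eq_one_of_det_eq_zero K hdet hg, finrank_ker_SbC_eq_of_det_eq_zero K hdet hg⟩

/-- **THE SEMISIMPLE SINGULAR TYPE: for `αδ = βγ`, `α + δ ≠ 0` the eigenvalue `(α+δ)^n` is SIMPLE** — its eigenspace is the image line (I21 `isCompl_ker_range_SbC_of_det_eq_zero`: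
the class space is `ker ⊕ range`, and `range` is the full `(α+δ)^n`-eigenspace). -/
theorem finrank_eigenspace_trace_pow_eq_one {α β γ δ : K} (hdet : α * δ - β * γ = 0) (htr : α + δ ≠ 0) :
    finrank K ↥(Module.End.eigenspace (SbC K α β γ δ (n := n)) ((α + δ) ^ n)) = 1 := by
  have hg : ¬ (α = 0 ∧ β = 0 ∧ γ = 0 ∧ δ = 0) := by rintro ⟨rfl, -, -, rfl⟩; exact htr (add_zero 0)
  have heq : Module.End.eigenspace (SbC K α β γ δ (n := n)) ((α + δ) ^ n) = LinearMap.range (SbC K α β γ δ (n := n)) := by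
    apply le_antisymm
    · intro f hf
      rw [Module.End.mem_eigenspace_iff] at hf
      have hu : (α + δ) ^ n ≠ 0 := pow_ne_zero n htr
      refine ⟨((α + δ) ^ n)⁻¹ • f, ?_⟩
      rw [map_smul, hf, smul_smul, inv_mul_cancel₀ hu, one_smul]
    · intro f hf
      exact Module.End.mem_eigenspace_iff.mpr (SbC_apply_of_mem_range K hdet hf)
  rw [heq, finrank_range_SbC_eq_one_of_det_eq_zero K hdet hg]

end Summit.Ventures.HSemireg.Wedge.HankelFrameChange
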